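import Summits.SmoothPoincare4.SmoothPoincare4.Theorems.CongruenceShadowsLieGateIdentityDerivations

/-!
# Word calculus in the surface Lie algebra: cut ideals meet bracket words in touching words

Support file for item stmt-SmoothPoincare4-13527 (`LieGateIdentity`, route
`SmoothPoincare4/CongruenceShadows`, card artin-approximation-trisection-groups K1 (ii)+(iii)),
over the definitions of `Literature/Algebra/Lie/SurfaceLieAlgebra.lean` (`SurfaceLieAlgebra R g`,
`grade`, `derDegree`, `cutIdeal`, `cutStabilizerDegree`, `s4CutSystem`).

For a word `w : FreeMagma (Fin g × Bool)` its multiset of letters is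
`(FreeMagma.lift (fun x => Multiplicative.ofAdd {x}) w).toAdd` (no new definition is introduced;
`letters_of`, `letters_mul`, `card_letters`), and `w` *touches* a cut system `S` if a letter of
`w` lies in `S`.
* `bracketWord_mul_mem_span` (right-normed rewriting, any Lie algebra): an iterated bracket of
  length `≥ 2` is an integer combination of brackets `⁅f y, ⟦w'⟧⁆` with the same letters (Jacobi).
* `bracketWord_mem_cutIdeal`: a bracket word touching `S` lies in the cut ideal `I_S`.
* `eq_zero_of_mem_span_avoid` (sections): if `S` hits every handle, an element of `I_S` in the
  span of the words avoiding `S` is zero — the Lie morphism `σ_S : 𝔰_g → FreeLie` killing the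
  letters of `S` exists (each `⁅aᵢ, bᵢ⁆` has a factor in `S`), `proj ∘ σ_S` fixes the words
  avoiding `S`, and `σ_S(I_S) = 0`.  Hence `mem_span_touch`: inside a span of bracket words, the
  elements of `I_S` lie in the span of the words touching `S` (no direct-sum decomposition of the
  grading is needed).
* `exists_data` (correction data): for a family of *coordinate* cut systems (exactly one letter of
  every handle), every element of the span of the words of length `d + 2` touching all of them is
  `Φ r` for generator data `r` of length `d + 1` with `r x ∈ I_S` whenever `x ∈ S`: put `±⟦w'⟧` of a
  right-normed term `⁅gen y, ⟦w'⟧⁆` at the partner letter `ȳ`; the systems containing `ȳ` are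
  exactly those missing `y`, and `w'` touches each of them.

No new definitions, no named facts.
-/

-- the prescribed namespace `Summit.<P>.<Sub>.…` duplicates `SmoothPoincare4` (P = Sub)
set_option linter.dupNamespace false

open Literature.Algebra.Lie Literature.Algebra.Lie.SurfaceLieAlgebra

namespace Summit.SmoothPoincare4.SmoothPoincare4.Theorems.LieGateIdentity

section Letters

variable {X : Type*}

/-- Letters of a one-letter word. [folklore] -/
theorem letters_of (x : X) : (FreeMagma.lift (fun x => Multiplicative.ofAdd ({x} : Multiset _))
    (FreeMagma.of x)).toAdd = ({x} : Multiset X) := rfl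

/-- Letters of a product. [folklore] -/
theorem letters_mul (u v : FreeMagma X) : (FreeMagma.lift (fun x => Multiplicative.ofAdd ({x} :
    Multiset _)) (u * v)).toAdd = (FreeMagma.lift (fun x => Multiplicative.ofAdd ({x} : Multiset _))
    u).toAdd + (FreeMagma.lift (fun x => Multiplicative.ofAdd ({x} : Multiset _)) v).toAdd := by
  rw [map_mul, toAdd_mul]

/-- The number of letters is the length. [folklore] -/
theorem card_letters (w : FreeMagma X) : Multiset.card ((FreeMagma.lift (fun x =>
    Multiplicative.ofAdd ({x} : Multiset _)) w).toAdd) = w.length := by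
  induction w using FreeMagma.recOnMul with
  | ih1 x => rfl
  | ih2 u v hu hv => rw [letters_mul, Multiset.card_add, hu, hv]; rfl

/-- **Right-normed rewriting.** In any Lie algebra, an iterated bracket `⟦u v⟧` is an integer
combination of brackets `⁅f y, ⟦w'⟧⁆` with a letter on the left and the same letters overall.
[folklore] -/
theorem bracketWord_mul_mem_span {R : Type*} [CommRing R] {M : Type*} [LieRing M] [LieAlgebra R M]
    (f : X → M) (u v : FreeMagma X) :
    bracketWord f (u * v) ∈ Submodule.span R
      ((fun p : X × FreeMagma X => ⁅f p.1, bracketWord f p.2⁆) '' {p | p.1 ::ₘ (FreeMagma.lift (fun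
          x => Multiplicative.ofAdd ({x} : Multiset _)) p.2).toAdd = (FreeMagma.lift (fun x =>
          Multiplicative.ofAdd ({x} : Multiset _)) (u * v)).toAdd}) := by
  induction u using FreeMagma.recOnMul generalizing v with
  | ih1 y =>
    refine Submodule.subset_span ⟨(y, v), ?_, rfl⟩
    change y ::ₘ (FreeMagma.lift (fun x => Multiplicative.ofAdd ({x} : Multiset _)) v).toAdd =
        (FreeMagma.lift (fun x => Multiplicative.ofAdd ({x} : Multiset _)) (FreeMagma.of y *
        v)).toAdd
    rw [letters_mul, letters_of, Multiset.singleton_add]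
  | ih2 u₁ u₂ h₁ h₂ =>
    have key : bracketWord f (u₁ * u₂ * v) =
        bracketWord f (u₁ * (u₂ * v)) - bracketWord f (u₂ * (u₁ * v)) := by
      simp only [bracketWord_mul]
      exact eq_sub_of_add_eq (leibniz_lie _ _ _).symm
    have e₁ : (FreeMagma.lift (fun x => Multiplicative.ofAdd ({x} : Multiset _)) (u₁ * (u₂ *
        v))).toAdd = (FreeMagma.lift (fun x => Multiplicative.ofAdd ({x} : Multiset _)) (u₁ * u₂ *
        v)).toAdd := by
      simp only [letters_mul, add_assoc]
    have e₂ : (FreeMagma.lift (fun x => Multiplicative.ofAdd ({x} : Multiset _)) (u₂ * (u₁ *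
        v))).toAdd = (FreeMagma.lift (fun x => Multiplicative.ofAdd ({x} : Multiset _)) (u₁ * u₂ *
        v)).toAdd := by
      simp only [letters_mul, add_left_comm, add_assoc]
    rw [key]
    refine sub_mem ?_ ?_
    · have := h₁ (u₂ * v); rwa [e₁] at this
    · have := h₂ (u₁ * v); rwa [e₂] at this

end Letters

variable {R : Type*} [CommRing R] {g : ℕ}

/-- A bracket word with a letter in `S` lies in the cut ideal `I_S`. [folklore] -/
theorem bracketWord_mem_cutIdeal {S : Set (Fin g × Bool)} {w : FreeMagma (Fin g × Bool)}
    (h : ∃ x ∈ (FreeMagma.lift (fun x => Multiplicative.ofAdd ({x} : Multiset _)) w).toAdd, x ∈ S) :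
        bracketWord (gen R g) w ∈ cutIdeal R g S := by
  induction w using FreeMagma.recOnMul with
  | ih1 y =>
    obtain ⟨x, hx, hxS⟩ := h
    rw [letters_of, Multiset.mem_singleton] at hx
    subst hx
    exact gen_mem_cutIdeal R g hxS
  | ih2 u v hu hv =>
    obtain ⟨x, hx, hxS⟩ := h
    rw [letters_mul, Multiset.mem_add] at hx
    rw [bracketWord_mul]
    rcases hx with hx | hx
    · exact lie_mem_left R _ (cutIdeal R g S) _ _ (hu ⟨x, hx, hxS⟩)
    · exact lie_mem_right R _ (cutIdeal R g S) _ _ (hv ⟨x, hx, hxS⟩)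

/-- **Sections.** If `S` hits every handle, an element of `I_S` lying in the span of the bracket
words avoiding `S` vanishes: the morphism killing the letters of `S` is injective on that span
(`proj` is a left inverse there) and kills `I_S`. [folklore] -/
theorem eq_zero_of_mem_span_avoid {S : Set (Fin g × Bool)}
    (hS : ∀ i : Fin g, (i, false) ∈ S ∨ (i, true) ∈ S) {z : SurfaceLieAlgebra R g}
    (hz : z ∈ Submodule.span R (bracketWord (gen R g) '' {w | ∀ x ∈ (FreeMagma.lift (fun x =>
        Multiplicative.ofAdd ({x} : Multiset _)) w).toAdd, x ∉ S}))
    (hzS : z ∈ cutIdeal R g S) : z = 0 := by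
  classical
  let f : Fin g × Bool → FreeLieAlgebra R (Fin g × Bool) :=
    fun x => if x ∈ S then 0 else FreeLieAlgebra.of R x
  have hf : ∑ i : Fin g, ⁅f (i, false), f (i, true)⁆ = 0 :=
    Finset.sum_eq_zero fun i _ => by rcases hS i with h | h <;> simp [f, h]
  let σ : SurfaceLieAlgebra R g →ₗ⁅R⁆ FreeLieAlgebra R (Fin g × Bool) := SurfaceLieAlgebra.lift f hf
  -- `proj ∘ σ` fixes the words avoiding `S`
  have hfix : ∀ w : FreeMagma (Fin g × Bool), (∀ x ∈ (FreeMagma.lift (fun x => Multiplicative.ofAdd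
      ({x} : Multiset _)) w).toAdd, x ∉ S) →
      proj R g (σ (bracketWord (gen R g) w)) = bracketWord (gen R g) w := by
    intro w
    induction w using FreeMagma.recOnMul with
    | ih1 y =>
      intro hy
      have hyS : y ∉ S := hy y (by rw [letters_of]; exact Multiset.mem_singleton_self y)
      simp [σ, f, hyS]
    | ih2 u v hu hv =>
      intro huv
      rw [letters_mul] at huv
      rw [bracketWord_mul, LieHom.map_lie, LieHom.map_lie,
        hu fun x hx => huv x (Multiset.mem_add.2 (Or.inl hx)),
        hv fun x hx => huv x (Multiset.mem_add.2 (Or.inr hx))]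
  have hz1 : proj R g (σ z) = z := by
    refine Submodule.span_induction ?_ ?_ ?_ ?_ hz
    · rintro _ ⟨w, hw, rfl⟩; exact hfix w hw
    · simp
    · intro x y _ _ hx hy; rw [map_add, map_add, hx, hy]
    · intro t x _ hx; rw [map_smul, map_smul, hx]
  -- `σ` kills `I_S`
  have hz2 : σ z = 0 := by
    have hle : cutIdeal R g S ≤ σ.ker := by
      change LieSubmodule.lieSpan R _ (gen R g '' S) ≤ σ.ker
      rw [LieSubmodule.lieSpan_le]
      rintro _ ⟨x, hx, rfl⟩
      rw [SetLike.mem_coe, LieHom.mem_ker]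
      simp [σ, f, hx]
    exact LieHom.mem_ker.1 (hle hzS)
  rw [← hz1, hz2, map_zero]

/-- **Touching words suffice.** If `S` hits every handle, an element of `I_S` in the span of the
bracket words satisfying `P` already lies in the span of those words satisfying `P` that touch
`S`. [folklore] -/
theorem mem_span_touch {S : Set (Fin g × Bool)}
    (hS : ∀ i : Fin g, (i, false) ∈ S ∨ (i, true) ∈ S) {P : FreeMagma (Fin g × Bool) → Prop}
    {u : SurfaceLieAlgebra R g} (hu : u ∈ Submodule.span R (bracketWord (gen R g) '' {w | P w}))
    (huS : u ∈ cutIdeal R g S) :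
    u ∈ Submodule.span R (bracketWord (gen R g) '' {w | P w ∧ ∃ x ∈ (FreeMagma.lift (fun x =>
        Multiplicative.ofAdd ({x} : Multiset _)) w).toAdd, x ∈ S}) := by
  have hsplit : Submodule.span R (bracketWord (gen R g) '' {w | P w}) ≤
      Submodule.span R (bracketWord (gen R g) '' {w | P w ∧ ∃ x ∈ (FreeMagma.lift (fun x =>
          Multiplicative.ofAdd ({x} : Multiset _)) w).toAdd, x ∈ S}) ⊔
        Submodule.span R (bracketWord (gen R g) '' {w | ∀ x ∈ (FreeMagma.lift (fun x =>
            Multiplicative.ofAdd ({x} : Multiset _)) w).toAdd, x ∉ S}) := by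
    rw [Submodule.span_le]
    rintro _ ⟨w, hw, rfl⟩
    by_cases h : ∃ x ∈ (FreeMagma.lift (fun x => Multiplicative.ofAdd ({x} : Multiset _)) w).toAdd,
        x ∈ S
    · exact Submodule.mem_sup_left (Submodule.subset_span ⟨w, ⟨hw, h⟩, rfl⟩)
    · push Not at h
      exact Submodule.mem_sup_right (Submodule.subset_span ⟨w, h, rfl⟩)
  obtain ⟨p, hp, z, hz, rfl⟩ := Submodule.mem_sup.1 (hsplit hu)
  have hpS : p ∈ cutIdeal R g S := by
    have : Submodule.span R (bracketWord (gen R g) '' {w | P w ∧ ∃ x ∈ (FreeMagma.lift (fun x =>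
        Multiplicative.ofAdd ({x} : Multiset _)) w).toAdd, x ∈ S}) ≤
        (cutIdeal R g S).toSubmodule := by
      rw [Submodule.span_le]
      rintro _ ⟨w, hw, rfl⟩
      exact bracketWord_mem_cutIdeal hw.2
    exact this hp
  have hzS : z ∈ cutIdeal R g S := by
    have := sub_mem huS hpS
    rwa [add_sub_cancel_left] at this
  rw [eq_zero_of_mem_span_avoid hS hz hzS, add_zero]
  exact hp

section Data

variable {R : Type*} [CommRing R] {g : ℕ}

/-- **Correction data.** Let `T` be a family of coordinate cut systems (each contains exactly one
letter of every handle).  Every element of the span of bracket words of length `d + 2` touching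
every `S ∈ T` is `Φ r` for some generator data `r` of bracket length `d + 1` with `r x ∈ I_S`
whenever `x ∈ S ∈ T`: rewrite each word right-normed, `⁅gen y, ⟦w'⟧⁆`, and put `±⟦w'⟧` at the
partner letter `ȳ` of `y`; the systems containing `ȳ` are exactly those missing `y`, and `w'`
touches each of them. [folklore] -/
theorem exists_data {T : Set (Fin g × Bool) → Prop}
    (hT : ∀ S, T S → ∀ x : Fin g × Bool, x ∈ S ↔ (x.1, !x.2) ∉ S)
    {d : ℕ} {W : Set (FreeMagma (Fin g × Bool))}
    (hW : ∀ w ∈ W, w.length = d + 2 ∧ ∀ S, T S → ∃ x ∈ (FreeMagma.lift (fun x =>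
        Multiplicative.ofAdd ({x} : Multiset _)) w).toAdd, x ∈ S)
    {q : SurfaceLieAlgebra R g} (hq : q ∈ Submodule.span R (bracketWord (gen R g) '' W)) :
    ∃ r : Fin g × Bool → SurfaceLieAlgebra R g, (∀ x, r x ∈ grade R g (d + 1)) ∧
      (∀ S, T S → ∀ x ∈ S, r x ∈ cutIdeal R g S) ∧ (∑ i : Fin g, (⁅a R g i, r (i, true)⁆ - ⁅b R g i,
          r (i, false)⁆)) = q := by
  classical
  -- closure properties of the conclusion
  have h0 : ∃ r : Fin g × Bool → SurfaceLieAlgebra R g, (∀ x, r x ∈ grade R g (d + 1)) ∧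
      (∀ S, T S → ∀ x ∈ S, r x ∈ cutIdeal R g S) ∧ (∑ i : Fin g, (⁅a R g i, r (i, true)⁆ - ⁅b R g i,
          r (i, false)⁆)) = 0 :=
    ⟨0, fun _ => Submodule.zero_mem _, fun _ _ _ _ => LieSubmodule.zero_mem _, phi_zero⟩
  have hadd : ∀ q₁ q₂ : SurfaceLieAlgebra R g,
      (∃ r : Fin g × Bool → SurfaceLieAlgebra R g, (∀ x, r x ∈ grade R g (d + 1)) ∧
        (∀ S, T S → ∀ x ∈ S, r x ∈ cutIdeal R g S) ∧ (∑ i : Fin g, (⁅a R g i, r (i, true)⁆ - ⁅b R g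
            i, r (i, false)⁆)) = q₁) →
      (∃ r : Fin g × Bool → SurfaceLieAlgebra R g, (∀ x, r x ∈ grade R g (d + 1)) ∧
        (∀ S, T S → ∀ x ∈ S, r x ∈ cutIdeal R g S) ∧ (∑ i : Fin g, (⁅a R g i, r (i, true)⁆ - ⁅b R g
            i, r (i, false)⁆)) = q₂) →
      (∃ r : Fin g × Bool → SurfaceLieAlgebra R g, (∀ x, r x ∈ grade R g (d + 1)) ∧
        (∀ S, T S → ∀ x ∈ S, r x ∈ cutIdeal R g S) ∧ (∑ i : Fin g, (⁅a R g i, r (i, true)⁆ - ⁅b R g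
            i, r (i, false)⁆)) = q₁ + q₂) := by
    rintro q₁ q₂ ⟨r₁, h₁, h₁', rfl⟩ ⟨r₂, h₂, h₂', rfl⟩
    exact ⟨r₁ + r₂, fun x => add_mem (h₁ x) (h₂ x),
      fun S hS x hx => add_mem (h₁' S hS x hx) (h₂' S hS x hx), phi_add r₁ r₂⟩
  have hsmul : ∀ (t : R) (q₁ : SurfaceLieAlgebra R g),
      (∃ r : Fin g × Bool → SurfaceLieAlgebra R g, (∀ x, r x ∈ grade R g (d + 1)) ∧
        (∀ S, T S → ∀ x ∈ S, r x ∈ cutIdeal R g S) ∧ (∑ i : Fin g, (⁅a R g i, r (i, true)⁆ - ⁅b R g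
            i, r (i, false)⁆)) = q₁) →
      (∃ r : Fin g × Bool → SurfaceLieAlgebra R g, (∀ x, r x ∈ grade R g (d + 1)) ∧
        (∀ S, T S → ∀ x ∈ S, r x ∈ cutIdeal R g S) ∧ (∑ i : Fin g, (⁅a R g i, r (i, true)⁆ - ⁅b R g
            i, r (i, false)⁆)) = t • q₁) := by
    rintro t q₁ ⟨r, h, h', rfl⟩
    exact ⟨t • r, fun x => Submodule.smul_mem _ t (h x),
      fun S hS x hx => (cutIdeal R g S).smul_mem t (h' S hS x hx), phi_smul t r⟩
  -- a single right-normed term `⁅gen (j, ε), t⁆`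
  have hsingle : ∀ (j : Fin g) (ε : Bool) (t : SurfaceLieAlgebra R g), t ∈ grade R g (d + 1) →
      (∀ S, T S → (j, !ε) ∈ S → t ∈ cutIdeal R g S) →
      ∃ r : Fin g × Bool → SurfaceLieAlgebra R g, (∀ x, r x ∈ grade R g (d + 1)) ∧
        (∀ S, T S → ∀ x ∈ S, r x ∈ cutIdeal R g S) ∧ (∑ i : Fin g, (⁅a R g i, r (i, true)⁆ - ⁅b R g
            i, r (i, false)⁆)) = ⁅gen R g (j, ε), t⁆ := by
    intro j ε t ht htS
    cases ε with
    | false =>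
      refine ⟨Pi.single ((j, true) : Fin g × Bool) t, fun x => ?_, fun S hS x hx => ?_,
        phi_single_true j t⟩
      · by_cases hx : x = (j, true)
        · subst hx; simpa using ht
        · simp [hx]
      · by_cases hx' : x = (j, true)
        · subst hx'; simpa using htS S hS hx
        · simp [hx']
    | true =>
      refine ⟨Pi.single ((j, false) : Fin g × Bool) (-t), fun x => ?_, fun S hS x hx => ?_, ?_⟩
      · by_cases hx : x = (j, false)
        · subst hx; simpa using ht
        · simp [hx]
      · by_cases hx' : x = (j, false)
        · subst hx'; simpa using htS S hS hx
        · simp [hx']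
      · rw [phi_single_false, lie_neg, neg_neg]; rfl
  -- induction over the span
  refine Submodule.span_induction ?_ h0 (fun q₁ q₂ _ _ => hadd q₁ q₂) (fun t q₁ _ => hsmul t q₁) hq
  rintro _ ⟨w, hw, rfl⟩
  obtain ⟨hlen, htouch⟩ := hW w hw
  induction w using FreeMagma.recOnMul with
  | ih1 x => exact absurd hlen (by simp)
  | ih2 u v _ _ =>
    refine Submodule.span_induction ?_ h0 (fun q₁ q₂ _ _ => hadd q₁ q₂) (fun t q₁ _ => hsmul t q₁)
      (bracketWord_mul_mem_span (R := R) (gen R g) u v)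
    rintro _ ⟨⟨y, w'⟩, hp, rfl⟩
    change y ::ₘ (FreeMagma.lift (fun x => Multiplicative.ofAdd ({x} : Multiset _)) w').toAdd =
        (FreeMagma.lift (fun x => Multiplicative.ofAdd ({x} : Multiset _)) (u * v)).toAdd at hp
    have hlen' : w'.length = d + 1 := by
      have h1 := card_letters (u * v)
      rw [← hp, Multiset.card_cons, card_letters, hlen] at h1
      omega
    obtain ⟨j, ε⟩ := y
    refine hsingle j ε (bracketWord (gen R g) w') (hlen' ▸ bracketWord_mem_wordGrade (gen R g) w')
      fun S hS hjS => bracketWord_mem_cutIdeal ?_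
    have hyS : ((j, ε) : Fin g × Bool) ∉ S := by
      have := (hT S hS (j, !ε)).1 hjS
      simpa using this
    obtain ⟨z, hz, hzS⟩ := htouch S hS
    rw [← hp, Multiset.mem_cons] at hz
    rcases hz with rfl | hz
    · exact absurd hzS hyS
    · exact ⟨z, hz, hzS⟩

end Data

end Summit.SmoothPoincare4.SmoothPoincare4.Theorems.LieGateIdentity
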